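import Mathlib.Analysis.SpecialFunctions.Log.Basic
import Literature.Computability.Complexity.Oracle
import Literature.Computability.Complexity.CircuitClasses
import Literature.Algebra.EuclideanLattices.Encoding
import HarnessLib

/-!
# Barrier: the fermion sign problem is `NP`-hard (Troyer–Wiese 2005)

Barrier catalogue `Literature/Barriers/HubbardSuperconductivity/` (D-0021), entry
`SignProblemNPHard` (seed barrier "sign problem (Troyer–Wiese NP-hardness)" for the summit
`HubbardSuperconductivity`: `d_{x²-y²}` pair-field long-range order in the ground states of the
doped repulsive two-dimensional Hubbard model).

## What is vendored (as printed)

Troyer–Wiese, *Computational complexity and fundamental limitations to fermionic quantum Monte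
Carlo simulations*, PRL **94** (2005) 170201 (`TroyerWiese2005`, held as
`paper:arxiv-cond-mat_0408370`):

* the definitions (Letter, p. 3 of the arXiv version): a QMC representation
  `⟨A⟩ = Σ_c A(c) p(c) / Σ_c p(c)` *suffers from a sign problem* if some `p(c) < 0`; the *related
  bosonic system* has weights `|p(c)|`, and `⟨A⟩ = ⟨A s⟩' / ⟨s⟩'` with `s = sign p`,
  `⟨s⟩ = Z/Z' = exp(-β N Δf)` so that the relative error grows as `e^{β N Δf}/√M`; an algorithm is
  *of polynomial complexity* if the time to reach relative error `ε` is `< κ ε⁻² Nⁿ βᵐ`; a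
  *solution of the sign problem* is a polynomial-complexity algorithm for `⟨A⟩` whenever the
  related bosonic system admits one;
* the reduction (p. 4): for the classical Ising spin glass `H = -Σ_{⟨j,k⟩} J_{jk} σ_j σ_k`,
  `J_{jk} ∈ {0, ±J}`, deciding whether a configuration of energy `≤ E₀` exists is `NP`-complete
  [Barahona 1982]; "by choosing an inverse temperature `β J ≥ N ln 2 + ln(12 N)` the thermal
  average of the energy will be less than `E₀ + J/2` if at least one configuration with energy
  `E₀` or less exists, and larger than `E₀ + J` otherwise"; the quantum model
  `H = -Σ J_{jk} σˣ_j σˣ_k` has a sign problem whose related bosonic model is the ferromagnet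
  (`J_{jk} ≥ 0`, polynomial cluster algorithms), hence "a generic solution of the sign problem
  would provide a polynomial time solution to this, and thus to all, NP-complete problems";
  footnote (bpp): a Monte Carlo solution decides "with arbitrarily high confidence", so strictly
  the conclusion is `NP ⊆ BPP` rather than `NP = P`.

Lean rendering. The mathematical content of the Letter is a polynomial-time Turing (Cook)
reduction from the Ising ground-state decision problem to *any* procedure returning thermal
energies of `H_J` at inverse temperature `β = poly(N)` to accuracy `O(J)`. We therefore state:

* `ISINGGROUND : Language Bool` — TW's family with `J = 1`: instances `(⟨n, J⟩, K)`, `J` an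
  `n × n` integer matrix with ALL entries in `{-1, 0, 1}` (`IsUnitCoupling`; entries above the
  diagonal are the couplings `J_{jk} ∈ {0, ±J}`, `J i j = 0` means "no bond"), `K : ℤ`; yes iff
  some `σ : Fin n → Bool` has `isingEnergy J σ ≤ K`. Matrices are coded by the tree's
  `Literature.Algebra.EuclideanLattices.encodingIntMatrixFin` (row-major sign–magnitude). Barahona's instances — problem
  P3 "Two-level spin glass: Given a two-level grid `G = (V, E)`, and a weighting function
  `J : E → {-1, 0, 1}`, find the minimum of `H`", "Theorem. P3 is NP-hard" (§4.2, p. 19; p. 20: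
  "finding a ground state in a three-dimensional spin glass is NP-hard, even in a two-level grid
  and with interactions restricted to be `{-1, 0, 1}`"), which TW describe as "a classical
  three-dimensional Ising spin glass" whose "couplings `J_{jk}` between nearest neighbor lattice
  points `j` and `k` are either `0` or `±J`" (Letter p. 4) — form a sublanguage embedded
  identically (as coupling matrices), so `ISINGGROUND` is `NP`-hard, and it is in `NP` (guess `σ`):
  `isingGround_isNPComplete` (named fact). The arbitrary-graph generality is forced by coding
  instances as matrices; see `scope_caveats`.
* `isingThermalEnergy J β = Σ_σ E_J(σ) e^{-β E_J(σ)} / Σ_σ e^{-β E_J(σ)}` and TW's printed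
  low-temperature lemma `lowTemperature_thermalEnergy_decides` (with "larger than `E₀ + J`"
  weakened to `≥ E₀ + J`, which is what holds when all levels coincide, and all that is used) —
  PROVED at the end of this file (`lowTemperature_thermalEnergy_decides_holds`).
* `IsIsingThermalOracle O`: the oracle `O : {0,1}* → {0,1}*` (`Literature.Computability.Complexity.Oracle`), queried
  with `⟨code ⟨n, J⟩, ⟨1ᵐ, 1^q⟩⟩` for a UNIT-coupling matrix `J` (TW's family only — nothing is
  required of `O` on other strings), answers `encode a`, `a : ℤ`, with
  `|a/(q+1) - ⟨H_J⟩_{β = m}| ≤ 1/(q+1)` — additive accuracy `1/(q+1)` at inverse temperature `m`,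
  both in unary, so that a polynomial-time machine may ask for `β, 1/ε ≤ poly(N)` exactly as in
  TW's `κ ε⁻² Nⁿ βᵐ`. This is the deterministic (function-oracle) abstraction of "a solution of
  the sign problem" for TW's family; TW's own footnote (bpp) applies to the randomised reading.
* `SignProblemNPHard : ∀ O, IsIsingThermalOracle O → NP ⊆ P^O` (`Literature.Computability.Complexity.PRel`), i.e. every
  such oracle is `NP`-hard under Cook reductions (same shape as the tree's
  `Literature.CplxCore.IsSharpPHard O := #P ⊆ FP^O`); `signProblem_decides_isingGround` is TW's own
  step `ISINGGROUND ∈ P^O`, and `SignProblemNPHard.of_facts` derives the barrier from that step,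
  `isingGround_isNPComplete` and the two closure facts `PolyTimeKarpReducible.turing`,
  `mem_PRel_of_polyTimeTuringReducible` of `Oracle.lean` (proved).

Nothing here is specific to the Hubbard model: that is the point of the barrier (a *generic*
sign-problem solver is excluded unless `NP ⊆ P^O`, resp. `NP ⊆ BPP`); the Hubbard-specific
facts (where determinant QMC is sign-free, how the average sign decays) are cited in the
BARRIER block from `ArovasBergKivelsonRaghu2022` §6.2, `DeRaedtVonDerLinden1992` §8.7.1 and
`GubernatisKawashimaWerner2016` §5.4/§11.1 (after Loh et al. 1990, `LohEtAl1990`), not restated.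

## Audit 2026-08-15 (D-0021 barrier audit): NARROWED — `SignProblemNPHardNarrow`

The Lean statement `SignProblemNPHard` is TRUE (discharged, `SignProblemNPHard_holds` in
`SignProblemNPHardProofs.lean`); what the audit narrows is its REACH. The hardness is carried
entirely by the PROGRAMMABLE couplings — `2^{Θ(n²)}` unit-coupling matrices per size — over which a
"generic" solver must be uniformly correct. Relativising the oracle hypothesis to an instance
family `S` (`IsIsingThermalOracleOn S`, `SignProblemNPHardOn S`; the barrier is the case
`S = {unit-coupling matrices}`, `signProblemNPHard_iff_on`, and `SignProblemNPHardOn` is monotone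
in `S`), the audit proves (`SignProblemNPHardNarrowProofs.lean`): for every THIN sub-family — one
instance `𝒥 L` per size parameter `L`, with `L ≤ #spins` and unit couplings (`IsThinUnitFamily`;
e.g. any fixed translation-invariant `±1` pattern on the `L × L` torus, the shape of the summit's
own model family at fixed `t, U, δ`) — there is a CORRECT thermal oracle `O`, in the exact query /
answer format of `IsIsingThermalOracle`, with `P^O ⊆ P/poly` (a truth-table transducer over a
sparse language, then Meyer's theorem `P^{sparse} ⊆ P/poly`); hence the family version
`SignProblemNPHardOn (Set.range 𝒥)` implies `NP ⊆ P/poly` and `PH = Σ₂ᵖ` (Karp–Lipton): it is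
false unless the polynomial hierarchy collapses, and no reduction can ever establish it. This is
the unary-size phenomenon of Hamiltonian complexity ("there would only be one instance per problem
size, and the problem would be trivially in P/poly" [GottesmanIrani2013, §2]); every published
hardness theorem for Hubbard-type models accordingly programs the instance into site-dependent
fields [SchuchVerstraete2009]. Two further printed facts sharpen the caveats: in the summit's own
geometry (planar or toroidal 2D, nearest-neighbour, no field) TW's `±J` family is polynomial-time
solvable by Pfaffians / matching [Barahona1982, §3], and representation-independent ("intrinsic")
sign-problem theorems cover chiral topological phases only, not a time-reversal-invariant
`d_{x²-y²}` singlet superconductor [GolanSmithRingel2020, §1]. See the BARRIER block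
(`technique_class`, `scope_caveats` (vi)–(viii), `evasions_known`) and `SignProblemNPHardNarrow`.

## Mathlib / tree search

Mathlib: `Computability.Encoding`, `encodeNat`, `unaryEncodeNat`; no complexity classes.
Tree (`Literature/Computability/Complexity/`): `P`, `NP`, `FP`, `IsNPComplete`, `Oracle`,
`PRel` (`P^O`), `PolyTimeKarpReducible.turing`, `mem_PRel_of_polyTimeTuringReducible`,
`boolPair`, `encodingIntBool`, `Encoding.sigmaBool`, `Encoding.pairBool`, `Encoding.toLanguage`;
`Literature/Algebra/EuclideanLattices/Encoding.lean`: `Literature.Algebra.EuclideanLattices.encodingIntMatrixFin`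
(integer matrices, reused here); `Literature.Computability.Complexity.MAXCUT` (weighted cut);
`Literature/Probability/LatticeModels/IsingModel.lean`: `Literature.Probability.LatticeModels.isingHamiltonian` — UNIT
FERROMAGNETIC couplings on the edges of a graph plus a field and boundary condition, a different
object from the frustrated `{0, ±1}`-matrix energy `isingEnergy` needed here (no reuse). Nothing
else on Ising energies of `{0, ±J}` spin glasses, partition functions of classical spin systems on
`Fin n → Bool`, or sign problems (`lean search 'SignProblem|stoquastic|isingEnergy'`: no hits).

## References

* M. Troyer, U.-J. Wiese, PRL 94 (2005) 170201, arXiv:cond-mat/0408370 (`TroyerWiese2005`).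
* F. Barahona, J. Phys. A 15 (1982) 3241–3253 (`Barahona1982`, held as
  `paper:doi-10-1088-0305-4470-15-10-028`), §4.2: P3 and "Theorem. P3 is NP-hard" (p. 19), p. 20.
* R. E. Ladner, N. A. Lynch, A. L. Selman, Theoret. Comput. Sci. 1 (1975) 103–123, §2
  (`LadnerLynchSelman1975`; the closure facts of `Oracle.lean`).
* E. Y. Loh et al., PRB 41 (1990) 9301 (`LohEtAl1990`); H. De Raedt, W. von der Linden, ch. 8 of
  K. Binder (ed.), *The Monte Carlo Method in Condensed Matter Physics*, Springer 1992, §8.7.1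
  (`DeRaedtVonDerLinden1992`); Arovas–Berg–Kivelson–Raghu, Annu. Rev. CMP 13 (2022) §6.2
  (`ArovasBergKivelsonRaghu2022`); S. Chandrasekharan, U.-J. Wiese, PRL 83 (1999) 3116
  (`ChandrasekharanWiese1999`, TW ref. (merons)); J. Gubernatis, N. Kawashima, P. Werner, *Quantum Monte
  Carlo Methods*, CUP 2016, §5.4 (negative-sign problem, `⟨s⟩ = e^{-βNΔf}`) and §11.1
  (`GubernatisKawashimaWerner2016`).
* D. Gottesman, S. Irani, *The quantum and classical complexity of translationally invariant
  tiling and Hamiltonian problems*, Theory of Computing 9 (2013) 31–116 (FOCS 2009),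
  arXiv:0905.2419, §2 (`GottesmanIrani2013`).
* N. Schuch, F. Verstraete, *Computational complexity of interacting electrons and fundamental
  limitations of density functional theory*, Nature Physics 5 (2009) 732–735, arXiv:0712.0483,
  pp. 2–3 (`SchuchVerstraete2009`).
* O. Golan, A. Smith, Z. Ringel, *Intrinsic sign problem in fermionic and bosonic chiral
  topological matter*, Phys. Rev. Research 2 (2020) 043032, arXiv:2005.05566, §1
  (`GolanSmithRingel2020`); Z.-X. Li, H. Yao, Annu. Rev. CMP 10 (2019) 337–356 (`LiYao2019`).
* R. M. Karp, R. J. Lipton, STOC 1980 (`KarpLipton1980`; tree theorem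
  `Literature.Computability.Complexity.karp_lipton_holds`); S. R. Mahaney, JCSS 25 (1982) 130–143
  (`Mahaney1982`); U. Schöning 1995, §4 (`Schoning1995`; Meyer's theorem, tree theorem
  `Literature.Barriers.PneNP.PRel_subset_PPoly_of_isSparseLanguage_holds`).
-/

noncomputable section

namespace Literature.Barriers.HubbardSuperconductivity

open _root_.Computability Literature.Computability.Complexity Literature.Computability.Complexity.Nondeterministic Finset

/-! ### The Ising ground-state decision problem -/

/-- The Ising spin `s_i(σ) = ±1` of a Boolean spin configuration `σ` (`true ↦ +1`,
`false ↦ -1`). [cite: TroyerWiese2005, Letter p. 4, eq. `H = -Σ J_{jk} σ_j σ_k`, "the spins take the values ±1"] -/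
def spinSign {n : ℕ} (σ : Fin n → Bool) (i : Fin n) : ℤ :=
  if σ i then 1 else -1

/-- The Ising energy `E_J(σ) = - Σ_{i < j} J i j · s_i(σ) s_j(σ)` of the spin configuration
`σ : Fin n → Bool` for the integer coupling matrix `J` (only entries above the diagonal are
couplings; `J i j = 0` means "no bond"). This is TW's `H = -Σ_{⟨j,k⟩} J_{jk} σ_j σ_k` with the
bonds `⟨j,k⟩` and their couplings recorded in `J` (defined for all integer matrices; the
language and the oracle below use unit couplings `J_{jk} ∈ {0, ±1}` only).
[cite: TroyerWiese2005, Letter p. 4, classical spin-glass Hamiltonian] -/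
def isingEnergy {n : ℕ} (J : Matrix (Fin n) (Fin n) ℤ) (σ : Fin n → Bool) : ℤ :=
  -∑ i, ∑ j, if i < j then J i j * spinSign σ i * spinSign σ j else 0

/-- TW's coupling family with `J = 1`: every entry of the coupling matrix is `0` or `±1`
("the couplings `J_{jk}` are … either `0` or `±J`"). [cite: TroyerWiese2005, Letter p. 4] -/
def IsUnitCoupling {n : ℕ} (J : Matrix (Fin n) (Fin n) ℤ) : Prop :=
  ∀ i j, J i j = 0 ∨ J i j = 1 ∨ J i j = -1

/-- Yes-instances of the Ising ground-state problem for TW's family: pairs `(⟨n, J⟩, K)` with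
unit couplings such that some spin configuration has energy `E_J(σ) ≤ K` (TW: "to determine
whether a state with energy less than or equal to a bound `E₀` exists").
[cite: TroyerWiese2005, Letter p. 4] [cite: Barahona1982, §4.2, Theorem (P3 is NP-hard), p. 19] -/
def isingGroundSet : Set ((Σ n, Matrix (Fin n) (Fin n) ℤ) × ℤ) :=
  {p | IsUnitCoupling p.1.2 ∧ ∃ σ : Fin p.1.1 → Bool, isingEnergy p.1.2 σ ≤ p.2}

/-- Unfolding lemma for `isingGroundSet`. [folklore] -/
theorem mem_isingGroundSet_iff (p : (Σ n, Matrix (Fin n) (Fin n) ℤ) × ℤ) :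
    p ∈ isingGroundSet ↔
      IsUnitCoupling p.1.2 ∧ ∃ σ : Fin p.1.1 → Bool, isingEnergy p.1.2 σ ≤ p.2 :=
  Iff.rfl

/-- Integer coupling matrices `⟨n, J⟩` over `Bool`: `boolPair (encodeNat n) (row-major entries)`,
i.e. `sigmaBool` of the tree's `Literature.Algebra.EuclideanLattices.encodingIntMatrixFin` (sign–magnitude entries,
row-major). [cite: AroraBarak2009, §0.1] -/
def encodingIntMatrix : Encoding (Σ n, Matrix (Fin n) (Fin n) ℤ) Bool :=
  Encoding.sigmaBool Literature.Algebra.EuclideanLattices.encodingIntMatrixFin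

/-- Unfolding lemma for `encodingIntMatrix`. [folklore] -/
theorem encodingIntMatrix_encode (p : Σ n, Matrix (Fin n) (Fin n) ℤ) :
    encodingIntMatrix.encode p =
      boolPair (encodeNat p.1) ((Literature.Algebra.EuclideanLattices.encodingIntMatrixFin p.1).encode p.2) :=
  rfl

/-- The language `ISINGGROUND ⊆ {0,1}*`: encodings `⟨code ⟨n, J⟩, code K⟩` of the yes-instances
`isingGroundSet` (unit-coupling matrix in binary sign–magnitude row-major form, threshold
`K : ℤ`). [cite: TroyerWiese2005, Letter p. 4] [cite: Barahona1982, §4.2, Theorem (P3 is NP-hard), p. 19] -/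
def ISINGGROUND : Language Bool :=
  (encodingIntMatrix.pairBool encodingIntBool).toLanguage isingGroundSet

/-- **The Ising ground-state problem with couplings `J_{jk} ∈ {0, ±J}` is `NP`-complete.**
Barahona: problem P3, "Two-level spin glass: Given a two-level grid `G = (V, E)`, and a weighting
function `J : E → {-1, 0, 1}`, find the minimum of `H` … Theorem. P3 is NP-hard" (§4.2, p. 19),
"even in a two-level grid and with interactions restricted to be `{-1, 0, 1}`" (p. 20);
Troyer–Wiese use its decision version, "The specific NP-complete problem … to determine whether a
state with energy less than or equal to a bound `E₀` exists for a classical three-dimensional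
Ising spin glass" whose "couplings `J_{jk}` between nearest neighbor lattice points `j` and `k`
are either `0` or `±J`" (Letter p. 4). Those instances embed identically (as their coupling
matrices) into `ISINGGROUND`, which is therefore `NP`-hard, and `ISINGGROUND ∈ NP` (certificate
`σ`). Stated as a named fact.
[cite: Barahona1982, §4.2, Theorem (P3 is NP-hard), p. 19] [cite: TroyerWiese2005, Letter p. 4] -/
def isingGround_isNPComplete : Prop :=
  IsNPComplete ISINGGROUND

/-! ### Thermal energies and the low-temperature lemma -/

/-- The classical partition function `Z_J(β) = Σ_σ exp(-β E_J(σ))` of the Ising system with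
coupling matrix `J` on `n` spins. [cite: TroyerWiese2005, Letter p. 2, eq. (1) with `p(c) = exp(-β E(c))`] -/
def isingPartitionFunction {n : ℕ} (J : Matrix (Fin n) (Fin n) ℤ) (β : ℝ) : ℝ :=
  ∑ σ : Fin n → Bool, Real.exp (-β * (isingEnergy J σ : ℝ))

/-- The thermal energy `⟨H_J⟩_β = Σ_σ E_J(σ) e^{-β E_J(σ)} / Z_J(β)` (the observable `A = H` in
TW's `⟨A⟩ = Z⁻¹ Σ_c A(c) p(c)`). [cite: TroyerWiese2005, Letter p. 2 eq. (1) and p. 4 ("calculating the average energy of the spin glass at a large enough inverse temperature β")] -/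
def isingThermalEnergy {n : ℕ} (J : Matrix (Fin n) (Fin n) ℤ) (β : ℝ) : ℝ :=
  (∑ σ : Fin n → Bool, (isingEnergy J σ : ℝ) * Real.exp (-β * (isingEnergy J σ : ℝ))) /
    isingPartitionFunction J β

/-- The partition function is positive (a nonempty sum of exponentials; `Fin n → Bool` is
inhabited). [folklore] -/
theorem isingPartitionFunction_pos {n : ℕ} (J : Matrix (Fin n) (Fin n) ℤ) (β : ℝ) :
    0 < isingPartitionFunction J β :=
  Finset.sum_pos (fun _ _ => Real.exp_pos _) Finset.univ_nonempty

/-- **Troyer–Wiese's low-temperature lemma** (Letter p. 4, with `J = 1`, integer energy levels):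
if `β ≥ n ln 2 + ln(12 n)` then (i) if some configuration has energy `≤ E₀`, the thermal energy
is `< E₀ + 1/2`; (ii) if every configuration has energy `> E₀` (hence `≥ E₀ + 1`), the thermal
energy is `≥ E₀ + 1`. TW print "larger than `E₀ + J`" in (ii); equality occurs when all levels
coincide, so the non-strict form is stated (it is all the reduction uses: an energy estimate of
accuracy `< 1/4` separates the two cases). PROVED below (`lowTemperature_thermalEnergy_decides_holds`;
TW: "it can easily be shown"):
`⟨H⟩ - E_min ≤ Σ_{E(σ) > E_min} (E(σ) - E_min) e^{-β (E(σ) - E_min)} ≤ 2ⁿ e^{-β} ≤ 1/(12 n)`.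
[cite: TroyerWiese2005, Letter p. 4 ("by choosing an inverse temperature βJ ≥ N ln 2 + ln(12N) …") and footnote (bpp)] -/
def lowTemperature_thermalEnergy_decides : Prop :=
  ∀ (n : ℕ) (J : Matrix (Fin n) (Fin n) ℤ) (E₀ : ℤ) (β : ℝ), IsUnitCoupling J →
    (n : ℝ) * Real.log 2 + Real.log (12 * n) ≤ β →
      ((∃ σ : Fin n → Bool, isingEnergy J σ ≤ E₀) → isingThermalEnergy J β < E₀ + 1 / 2) ∧
        ((∀ σ : Fin n → Bool, E₀ < isingEnergy J σ) → (E₀ : ℝ) + 1 ≤ isingThermalEnergy J β)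

/-! ### "A solution of the sign problem" as an oracle, and the theorem -/

/-- The query string asking for the thermal energy of `⟨n, J⟩` at inverse temperature `β = m`
to accuracy `1/(q+1)`: `⟨code ⟨n, J⟩, ⟨1ᵐ, 1^q⟩⟩` with `m`, `q` in unary (`unaryEncodeNat`), so
that polynomially long queries reach exactly `β, 1/ε ≤ poly(N)` (TW: time `< κ ε⁻² Nⁿ βᵐ`).
[cite: TroyerWiese2005, Letter p. 3, definition of "polynomial complexity"] -/
def thermalQuery (p : Σ n, Matrix (Fin n) (Fin n) ℤ) (m q : ℕ) : List Bool :=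
  boolPair (encodingIntMatrix.encode p) (boolPair (unaryEncodeNat m) (unaryEncodeNat q))

/-- **Oracle form of "a solution of the sign problem" for TW's family.** For every UNIT-coupling
matrix `J` (`J_{jk} ∈ {0, ±1}`; nothing is required on other queries) `O` answers the query
`thermalQuery ⟨n, J⟩ m q` with the code of an integer `a` such that
`|a/(q+1) - ⟨H_J⟩_{β=m}| ≤ 1/(q+1)`: thermal energies of the Ising system with couplings `J`
(TW's `H = -Σ J_{jk} σˣσˣ`, whose sign-reweighted bosonic reference system is the ferromagnet
with couplings `|J_{jk}|`, so that `⟨H_J⟩ = ⟨H s⟩'/⟨s⟩'`) to any polynomial additive accuracy at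
any polynomial inverse temperature. A polynomial-complexity sign-problem solver in TW's sense
provides such answers (up to the confidence caveat of their footnote (bpp)); this deterministic
function-oracle abstraction is the tree's `Literature.Computability.Complexity.Oracle`.
[cite: TroyerWiese2005, Letter p. 3 (definitions) and p. 4 (`⟨A⟩ = ⟨As⟩'/⟨s⟩'`, quantum spin glass with a sign problem)] -/
def IsIsingThermalOracle (O : Oracle) : Prop :=
  ∀ (p : Σ n, Matrix (Fin n) (Fin n) ℤ) (m q : ℕ), IsUnitCoupling p.2 → ∃ a : ℤ,
    O (thermalQuery p m q) = encodingIntBool.encode a ∧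
      |(a : ℝ) / (q + 1) - isingThermalEnergy p.2 m| ≤ 1 / (q + 1)

/-- **Troyer–Wiese's reduction step**: with access to thermal energies (a solution of the sign
problem for their family) the `NP`-complete Ising ground-state problem is decidable in
polynomial time — query `β = m ≥ n ln 2 + ln(12 n)` at accuracy `1/4` and compare with `E₀ + 3/4`
(`lowTemperature_thermalEnergy_decides`). Cook-reduction form: `ISINGGROUND ∈ P^O`.
[cite: TroyerWiese2005, Letter p. 4 ("This question … can also be answered … by calculating the average energy of the spin glass at a large enough inverse temperature β")] -/
def signProblem_decides_isingGround : Prop :=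
  ∀ O : Oracle, IsIsingThermalOracle O → ISINGGROUND ∈ PRel O

/-- **BARRIER `SignProblemNPHard` (Troyer–Wiese 2005): the sign problem is `NP`-hard.** Every
oracle solving the sign problem for TW's family (`IsIsingThermalOracle`) is `NP`-hard under
polynomial-time Turing reductions: `NP ⊆ P^O`. As printed: "the sign problem is NP-hard,
implying that a generic solution of the sign problem would also solve all problems in the
complexity class NP in polynomial time" (abstract; by footnote (bpp) a Monte Carlo solution gives
`NP ⊆ BPP`). Obtained (`SignProblemNPHard.of_facts`, proved below) from TW's step
`signProblem_decides_isingGround`, Barahona's `isingGround_isNPComplete` and the closure of `P^O`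
under Karp/Cook reductions (`PolyTimeKarpReducible.turing`, `mem_PRel_of_polyTimeTuringReducible`).

technique_class: generic-sign-problem-cure instance-uniform-polynomial-time-thermal-simulation — ONE procedure returning thermal averages to additive accuracy `1/poly` at `β ≤ poly` for EVERY member of a programmable-coupling family (here: all `{0, ±1}` coupling matrices); NOT covered (audit 2026-08-15, `SignProblemNPHardNarrow`): quantum Monte Carlo as such, model-specific sign-problem-free or sign-mitigated sampling, and any method — stochastic or deterministic — specialised to a thin family (one instance per size, e.g. a fixed translation-invariant coupling pattern or the summit's fixed-`(t, U, δ)` Hubbard family), for which the barrier's conclusion would collapse `PH` [cite: TroyerWiese2005, Conclusions] [cite: GottesmanIrani2013, §2 (Problems and Results)].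
blocks: establishing HubbardSuperconductivity (or any ground-state / low-temperature property of the doped repulsive 2D Hubbard model) by a GENERIC polynomial-time sign-problem cure — a representation-independent fix of sign reweighting that would equally deliver the thermal averages of every frustrated `±J` transverse-Ising instance; it does NOT block a Hubbard-specific polynomial-time algorithm or certificate pipeline (`scope_caveats` (vi)–(viii), `SignProblemNPHardNarrow`) — determinant/world-line weights of the repulsive model at generic filling are not non-negative [cite: ArovasBergKivelsonRaghu2022, §6.2] [cite: DeRaedtVonDerLinden1992, §8.7.1], the average sign is `⟨s⟩ = Z/Z' = exp(-β N Δf)` with `Δf = O(1)` "when the difference between the two Hamiltonians is extensive" (after Loh et al. 1990, Hatano–Suzuki 1992) [cite: GubernatisKawashimaWerner2016, §5.4] [cite: DeRaedtVonDerLinden1992, §8.7.1] [cite: TroyerWiese2005, Letter p. 3], and no representation-independent polynomial-time cure exists unless `NP ⊆ P^O` (`NP ⊆ BPP` for randomised solvers) [cite: TroyerWiese2005, abstract and footnote (bpp)].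
because: for the frustrated transverse Ising family `H = -Σ J_{jk} σˣ_j σˣ_k`, `J_{jk} ∈ {0, ±J}`, the sign-reweighted average `⟨H⟩ = ⟨H s⟩'/⟨s⟩'` over the sign-free ferromagnetic reference system equals the spin-glass thermal energy, which at `βJ ≥ N ln 2 + ln(12N)` decides Barahona's `NP`-complete ground-state question to accuracy `J/2`; a polynomial-complexity evaluation of such averages therefore puts `NP` inside `P^O` [cite: TroyerWiese2005, Letter p. 4] [cite: Barahona1982, §4.2, Theorem (P3 is NP-hard), p. 19].
evasions_known: model-specific sign-free representations — TW: "This does not exclude that a specific sign problem can be solved for a restricted subclass of quantum systems", e.g. the meron-cluster algorithm [cite: TroyerWiese2005, Conclusions] [cite: ChandrasekharanWiese1999, abstract]; for the Hubbard model determinant QMC is sign-free at half filling on bipartite lattices (particle–hole symmetry) and for `U < 0` at zero magnetisation, and otherwise "by employing very large computational resources to overcome the sign problem" [cite: ArovasBergKivelsonRaghu2022, §6.2] [cite: DeRaedtVonDerLinden1992, §8.7.1 cases a)–c)]; none published for the single-band square lattice at `U > 0`, hole doping `δ ∈ (0, 1/2)`; symmetry-designed sign-free determinant-QMC classes (Kramers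 / Majorana / time-reversal positivity) are reviewed in [cite: LiYao2019, §2.1, §3.1 and §4.2], and electron–hole-doped repulsive Hubbard BILAYERS are simulated sign-free by such a design (Huang–Claassen–Huang et al., PRL 124 (2020) 077601), so doping per se forces no sign problem; in the summit's own geometry TW's family is not even hard — for planar or toroidal two-dimensional `±J` models without field the partition function (hence every thermal energy TW's reduction queries) is computable in polynomial time by Pfaffians and a ground state by minimum-weight perfect matching [cite: Barahona1982, §3.2–§3.3], hardness requiring two-level (3D) grids [cite: Barahona1982, §4.2, Theorem (P3 is NP-hard), p. 19] or a magnetic field [cite: Barahona1982, §4.3, Theorem (P5 is NP-hard) and closing remark]; deterministic certified-bound methods (Pfaffian/transfer evaluations, semidefinite / reduced-density-matrix lower bounds, cluster bounds) are not sign-problem solvers at all and lie outside the technique class.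
scope_caveats: what is proved is worst-case `NP`-hardness of a GENERIC sign-problem solver, exhibited on one designed family (the classical `±J` spin glass written in the `σˣ` basis) — "the sign problem is not an intrinsic property of the quantum model studied but is representation-dependent" and "This does not exclude that a specific sign problem can be solved for a restricted subclass of quantum systems" [cite: TroyerWiese2005, Letter p. 4 and Conclusions]; nothing is proved about the complexity of the doped Hubbard model itself, about average-case instances, or about non-stochastic methods; for randomised (Monte Carlo) solvers the printed conclusion is `NP ⊆ BPP`, not `P = NP` [cite: TroyerWiese2005, footnote (bpp)]; that sign-weighted averages of fermion simulations vanish exponentially in `N` and `β` rests on "various heuristic arguments … and the experience from countless simulations", not on a theorem [cite: GubernatisKawashimaWerner2016, §11.1 and §5.4]; the Lean statement abstracts "a solution of the sign problem" as a deterministic function oracle for thermal energies at unary `β`, `1/ε` (TW's `κ ε⁻² Nⁿ βᵐ`) of the unit-coupling family on ARBITRARY interaction graphs (instances are coded as `{0, ±1}` matrices), whereas TW's printed family is the nearest-neighbour "classical three-dimensional Ising spin glass" [cite: TroyerWiese2005, Letter p. 4] — so the Lean no-go literally excludes only solvers that are correct on every graph, a narrower class of solvers than the printed one; and `isingGround_isNPComplete`,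 `signProblem_decides_isingGround` are vendored as named facts here and discharged in the sibling files (`SignProblemNPHardIsingComplete.lean`, `SignProblemNPHardIsingGround.lean`; the barrier itself is `SignProblemNPHard_holds`, `SignProblemNPHardProofs.lean`); AUDIT 2026-08-15 (NARROWED): (vi) THIN FAMILIES — the hardness is carried by the `2^{Θ(n²)}` programmable coupling matrices per size: for every sub-family with one instance per size parameter (`IsThinUnitFamily 𝒥`: `L ≤ #spins`, unit couplings) there is a CORRECT oracle `O` in the exact format of `IsIsingThermalOracle` with `P^O ⊆ P/poly` (`SignProblemNPHardNarrow`, proved in `SignProblemNPHardNarrowProofs.lean` from Meyer's theorem `P^{sparse} ⊆ P/poly` [cite: Schoning1995, §4, Theorem (Karp–Lipton 1980; Berman–Hartmanis 1977), (c) → (a) (pp. 528–529)]), so the family version `SignProblemNPHardOn (Set.range 𝒥)` implies `NP ⊆ P/poly` and `PH = Σ₂ᵖ` [cite: KarpLipton1980] (cf. sparse `NP`-hard sets [cite: Mahaney1982, Thm. 3.1 and Thm. 4.1–4.2]) — it is false unless the polynomial hierarchy collapses and unprovable by any reduction; this is the unary-size phenomenon "If it were instead given in unary, there would only be one instance per problem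 size, and the problem would be trivially in P/poly" [cite: GottesmanIrani2013, §2 (Problems and Results)]; the summit's model family (fixed `t, U, δ`, size `L`; `O(1)` real parameters seen to accuracy `1/poly`) is of this thin kind, and every published hardness theorem for Hubbard-type models programs the instance into SITE-DEPENDENT fields — "this is the only term which we can tune locally … the presence of a magnetic field is crucial for the construction, as it is the only set of parameters available to encode a computational problem" [cite: SchuchVerstraete2009, arXiv:0712.0483 pp. 2–3 (2D Hubbard model with local magnetic fields is QMA-complete)]; (vii) representation-INDEPENDENT ("intrinsic") sign-problem theorems exist for gapped chiral / topological phases (criterion `e^{2πic/24} ∉ {θ_a}`; bosonic non-chiral topological orders), which do not cover a time-reversal-invariant singlet `d_{x²-y²}` superconductor, and their authors list the repulsive Hubbard model among the problems with no known obstruction [cite: GolanSmithRingel2020, §1 (Introduction; arXiv:2005.05566 pp. 2–4)]; (viii) in strictly two-dimensional nearest-neighbour geometry without field TW's own family is polynomial-time solvable [cite: Barahona1982, §3.2–§3.3 and §4.3 closing remark], so the `NP`-hardness in this 2D summit's catalogue is imported from non-planar (two-level / 3D) coupling graphs or fields, not from the summit's lattice.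
status: established (the reduction [cite: TroyerWiese2005, Letter p. 4] and `NP`-completeness of the spin-glass ground state [cite: Barahona1982, §4.2, Theorem (P3 is NP-hard), p. 19] are theorems; that no Hubbard-specific cure exists at `U > 0`, `δ > 0` is folklore, printed as expectation in [cite: TroyerWiese2005, Conclusions])
[cite: TroyerWiese2005, abstract, Letter p. 4 and footnote (bpp)] -/
def SignProblemNPHard : Prop :=
  ∀ O : Oracle, IsIsingThermalOracle O → NP ⊆ PRel O

/-- Unfolding: the barrier statement is `NP ⊆ P^O` for every thermal-energy oracle. [folklore] -/
theorem signProblemNPHard_iff :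
    SignProblemNPHard ↔ ∀ O : Oracle, IsIsingThermalOracle O → NP ⊆ PRel O :=
  Iff.rfl

/-- From the barrier and `NP`-completeness of `ISINGGROUND` one recovers TW's reduction step
`ISINGGROUND ∈ P^O`. [cite: TroyerWiese2005, Letter p. 4] -/
theorem SignProblemNPHard.decides_isingGround (h : SignProblemNPHard)
    (hNP : isingGround_isNPComplete) : signProblem_decides_isingGround :=
  fun O hO => h O hO hNP.1

/-- **Assembly of the barrier from its genuine inputs** (Troyer–Wiese's argument): if a
sign-problem oracle decides `ISINGGROUND` in polynomial time (TW's step) and `ISINGGROUND` is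
`NP`-complete (Barahona), then every `L ∈ NP` Karp-reduces to `ISINGGROUND`, hence Cook-reduces
to it (`PolyTimeKarpReducible.turing`), hence lies in `P^O` (`mem_PRel_of_polyTimeTuringReducible`,
closure of `P^O` under Cook reductions): `NP ⊆ P^O`. The two closure facts are the named facts of
`Oracle.lean` (the first is discharged in `OracleProofs.lean`).
[cite: TroyerWiese2005, Letter p. 4] [cite: LadnerLynchSelman1975, §2] -/
theorem SignProblemNPHard.of_facts (h₁ : signProblem_decides_isingGround)
    (h₂ : isingGround_isNPComplete) (hKT : PolyTimeKarpReducible.turing)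
    (hPRel : mem_PRel_of_polyTimeTuringReducible) : SignProblemNPHard :=
  fun O hO L hL => hPRel (hKT (h₂.2 L hL)) (h₁ O hO)

/-! ### Proof of Troyer–Wiese's low-temperature lemma (`lowTemperature_thermalEnergy_decides_holds`)

TW: "it can easily be shown that" at `βJ ≥ N ln 2 + ln(12N)` the thermal energy is below
`E₀ + J/2` if a configuration of energy `≤ E₀` exists and at least `E₀ + J` otherwise. Proof
(energies are integers): (ii) is an average of energies `≥ E₀ + 1`; for (i) let `m = min E`;
then `⟨H⟩ - m = Σ_σ (E(σ) - m) e^{-βE(σ)}/Z` with `Z ≥ e^{-βm}`, and each term with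
`x = E(σ) - m ≥ 1` is `≤ x e^{-βx} e^{-βm} ≤ e^{-β} e^{-βm}` (as `β ≥ 1`), so
`⟨H⟩ - m ≤ 2ⁿ e^{-β} ≤ 1/(12n) < 1/2`. -/

/-- `x e^{-βx} ≤ e^{-β}` for `x ≥ 1`, `β ≥ 1` (from `x ≤ e^{x-1}`). [folklore] -/
theorem mul_exp_neg_mul_le {x β : ℝ} (hx : 1 ≤ x) (hβ : 1 ≤ β) :
    x * Real.exp (-β * x) ≤ Real.exp (-β) := by
  have h1 : x ≤ Real.exp (x - 1) := by
    have := Real.add_one_le_exp (x - 1)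
    linarith
  calc x * Real.exp (-β * x) ≤ Real.exp (x - 1) * Real.exp (-β * x) := by
        gcongr
    _ = Real.exp (-β + (x - 1) * (1 - β)) := by rw [← Real.exp_add]; ring_nf
    _ ≤ Real.exp (-β) := by
        apply Real.exp_le_exp.2
        nlinarith

/-- **Troyer–Wiese's low-temperature lemma — PROVED** (`lowTemperature_thermalEnergy_decides`
holds; the unit-coupling hypothesis is not even needed, only integrality of the energies).
[cite: TroyerWiese2005, Letter p. 4] -/
theorem lowTemperature_thermalEnergy_decides_holds : lowTemperature_thermalEnergy_decides := by
  intro n J E₀ β _hJ hβ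
  have hZ : 0 < isingPartitionFunction J β := isingPartitionFunction_pos J β
  refine ⟨?_, ?_⟩
  · -- (i): a configuration of energy `≤ E₀` forces `⟨H⟩ < E₀ + 1/2`
    rintro ⟨σ₁, hσ₁⟩
    obtain ⟨σ₀, -, hmin⟩ :=
      Finset.exists_min_image Finset.univ (fun σ : Fin n → Bool => isingEnergy J σ)
        Finset.univ_nonempty
    set m : ℝ := (isingEnergy J σ₀ : ℝ) with hm
    have hmE0 : m ≤ (E₀ : ℝ) := by
      rw [hm]; exact_mod_cast (hmin σ₁ (Finset.mem_univ _)).trans hσ₁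
    -- `Z ≥ e^{-βm}`
    have hZm : Real.exp (-β * m) ≤ isingPartitionFunction J β := by
      unfold isingPartitionFunction
      exact Finset.single_le_sum (f := fun σ : Fin n → Bool =>
        Real.exp (-β * (isingEnergy J σ : ℝ))) (fun _ _ => (Real.exp_pos _).le)
        (Finset.mem_univ σ₀)
    -- termwise bound
    have hterm : ∀ σ : Fin n → Bool,
        ((isingEnergy J σ : ℝ) - m) * Real.exp (-β * (isingEnergy J σ : ℝ)) ≤
          Real.exp (-β) * Real.exp (-β * m) := by
      intro σ
      have hle : isingEnergy J σ₀ ≤ isingEnergy J σ := hmin σ (Finset.mem_univ _)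
      rcases eq_or_lt_of_le hle with heq | hlt
      · -- `E(σ) = m`: the term vanishes
        have : ((isingEnergy J σ : ℝ) - m) = 0 := by rw [hm, heq]; ring
        rw [this, zero_mul]
        positivity
      · -- `E(σ) ≥ m + 1`; then `n ≥ 1` and `β ≥ 1`
        have hx : (1 : ℝ) ≤ (isingEnergy J σ : ℝ) - m := by
          rw [hm]
          have : isingEnergy J σ₀ + 1 ≤ isingEnergy J σ := hlt
          exact_mod_cast (by linarith : (1 : ℤ) ≤ isingEnergy J σ - isingEnergy J σ₀)
        have hn : 1 ≤ n := by
          rcases Nat.eq_zero_or_pos n with h0 | hpos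
          · subst h0
            exact absurd (congrArg (isingEnergy J) (Subsingleton.elim σ₀ σ)) (ne_of_lt hlt)
          · exact hpos
        have hβ1 : (1 : ℝ) ≤ β := by
          have h12 : (1 : ℝ) ≤ Real.log (12 * n) := by
            rw [Real.le_log_iff_exp_le (by positivity)]
            have hn' : (1 : ℝ) ≤ n := by exact_mod_cast hn
            -- `e ≤ 4`: `e^{-1/2} ≥ 1/2` (tangent line), so `e^{1/2} ≤ 2`
            have hhalf : (2 : ℝ)⁻¹ ≤ Real.exp (-(1 / 2)) := by
              have := Real.add_one_le_exp (-(1 / 2 : ℝ))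
              norm_num at this ⊢
              linarith
            have hexp_half : Real.exp (1 / 2) ≤ 2 := by
              rw [show (1 / 2 : ℝ) = -(-(1 / 2)) by ring, Real.exp_neg,
                inv_le_comm₀ (Real.exp_pos _) two_pos]
              exact hhalf
            have he : Real.exp 1 ≤ 4 := by
              have h2 : Real.exp 1 = Real.exp (1 / 2) * Real.exp (1 / 2) := by
                rw [← Real.exp_add]; norm_num
              rw [h2]
              nlinarith [Real.exp_pos (1 / 2 : ℝ)]
            nlinarith
          have h2 : (0 : ℝ) ≤ n * Real.log 2 := by positivity
          linarith
        set x : ℝ := (isingEnergy J σ : ℝ) - m with hxdef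
        have hsplit : Real.exp (-β * (isingEnergy J σ : ℝ)) =
            Real.exp (-β * x) * Real.exp (-β * m) := by
          rw [← Real.exp_add, hxdef]; ring_nf
        rw [hsplit, ← mul_assoc]
        exact mul_le_mul_of_nonneg_right (mul_exp_neg_mul_le hx hβ1) (Real.exp_pos _).le
    -- sum the termwise bound
    have hsum : ∑ σ : Fin n → Bool,
        ((isingEnergy J σ : ℝ) - m) * Real.exp (-β * (isingEnergy J σ : ℝ)) ≤
          (2 : ℝ) ^ n * (Real.exp (-β) * Real.exp (-β * m)) := by
      calc ∑ σ : Fin n → Bool, ((isingEnergy J σ : ℝ) - m) * Real.exp (-β * (isingEnergy J σ : ℝ))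
          ≤ ∑ _σ : Fin n → Bool, Real.exp (-β) * Real.exp (-β * m) :=
            Finset.sum_le_sum fun σ _ => hterm σ
        _ = (2 : ℝ) ^ n * (Real.exp (-β) * Real.exp (-β * m)) := by
            simp [Finset.sum_const, Finset.card_univ]
    -- `⟨H⟩ - m = Σ (E - m) e^{-βE} / Z`
    have hdiff : isingThermalEnergy J β - m =
        (∑ σ : Fin n → Bool, ((isingEnergy J σ : ℝ) - m) * Real.exp (-β * (isingEnergy J σ : ℝ))) /
          isingPartitionFunction J β := by
      unfold isingThermalEnergy
      rw [eq_div_iff hZ.ne', sub_mul, div_mul_cancel₀ _ hZ.ne', isingPartitionFunction,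
        Finset.mul_sum, ← Finset.sum_sub_distrib]
      refine Finset.sum_congr rfl fun σ _ => ?_
      ring
    -- `⟨H⟩ - m ≤ 2ⁿ e^{-β}`
    have hbound : isingThermalEnergy J β - m ≤ (2 : ℝ) ^ n * Real.exp (-β) := by
      rw [hdiff, div_le_iff₀ hZ]
      calc ∑ σ : Fin n → Bool, ((isingEnergy J σ : ℝ) - m) * Real.exp (-β * (isingEnergy J σ : ℝ))
          ≤ (2 : ℝ) ^ n * (Real.exp (-β) * Real.exp (-β * m)) := hsum
        _ = (2 : ℝ) ^ n * Real.exp (-β) * Real.exp (-β * m) := by ring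
        _ ≤ (2 : ℝ) ^ n * Real.exp (-β) * isingPartitionFunction J β := by
            gcongr
    -- `2ⁿ e^{-β} < 1/2` when `n ≥ 1`; the case `n = 0` is degenerate (`⟨H⟩ = m`)
    rcases Nat.eq_zero_or_pos n with h0 | hpos
    · subst h0
      have hzero : ∑ σ : Fin 0 → Bool,
          ((isingEnergy J σ : ℝ) - m) * Real.exp (-β * (isingEnergy J σ : ℝ)) = 0 := by
        refine Finset.sum_eq_zero fun σ _ => ?_
        have : ((isingEnergy J σ : ℝ) - m) = 0 := by
          rw [hm, Subsingleton.elim σ₀ σ]; ring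
        rw [this, zero_mul]
      have : isingThermalEnergy J β - m = 0 := by rw [hdiff, hzero, zero_div]
      linarith
    · have hsmall : (2 : ℝ) ^ n * Real.exp (-β) ≤ 1 / 12 := by
        have hn' : (1 : ℝ) ≤ n := by exact_mod_cast hpos
        have hexp : Real.exp (-β) ≤ Real.exp (-((n : ℝ) * Real.log 2 + Real.log (12 * n))) :=
          Real.exp_le_exp.2 (by linarith)
        have hval : Real.exp (-((n : ℝ) * Real.log 2 + Real.log (12 * n))) =
            ((2 : ℝ) ^ n)⁻¹ * (12 * (n : ℝ))⁻¹ := by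
          rw [neg_add, Real.exp_add, Real.exp_neg, Real.exp_neg, ← Real.log_rpow two_pos,
            Real.exp_log (by positivity), Real.exp_log (by positivity), Real.rpow_natCast]
        calc (2 : ℝ) ^ n * Real.exp (-β)
            ≤ (2 : ℝ) ^ n * (((2 : ℝ) ^ n)⁻¹ * (12 * (n : ℝ))⁻¹) := by
              rw [← hval]; exact mul_le_mul_of_nonneg_left hexp (by positivity)
          _ = (12 * (n : ℝ))⁻¹ := by field_simp
          _ ≤ 1 / 12 := by
              rw [one_div]
              exact inv_anti₀ (by norm_num) (by nlinarith)
      linarith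
  · -- (ii): all energies `> E₀`, hence `≥ E₀ + 1`, so the average is `≥ E₀ + 1`
    intro hall
    have hge : ∀ σ : Fin n → Bool, (E₀ : ℝ) + 1 ≤ (isingEnergy J σ : ℝ) := fun σ => by
      exact_mod_cast (hall σ : E₀ + 1 ≤ isingEnergy J σ)
    unfold isingThermalEnergy
    rw [le_div_iff₀ hZ]
    unfold isingPartitionFunction
    rw [Finset.mul_sum]
    exact Finset.sum_le_sum fun σ _ =>
      mul_le_mul_of_nonneg_right (hge σ) (Real.exp_pos _).le

/-! ### Audit 2026-08-15 (NARROWED): the barrier relativised to an instance family, and thin families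

The oracle hypothesis `IsIsingThermalOracle` asks for correct thermal energies of EVERY unit-coupling
matrix — `2^{Θ(n²)}` instances per size; that is where the `NP`-hardness lives. Relativising it to a
family `S` of instances gives the barrier SHAPE `SignProblemNPHardOn S` ("every solver correct on `S`
is `NP`-hard"), monotone in `S`; the barrier is the case `S = {p | IsUnitCoupling p.2}`. The
narrowed fact `SignProblemNPHardNarrow` records, next to the barrier, that for THIN sub-families
(one instance per size parameter) a correct solver exists that is `P/poly`-weak, so that the family
version of the barrier would collapse the polynomial hierarchy (Karp–Lipton); proofs in
`SignProblemNPHardNarrowProofs.lean` (`SignProblemNPHardNarrow_holds`,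
`NP_subset_PPoly_of_signProblemNPHardOn_range`, `PH_eq_SigmaP_two_of_signProblemNPHardOn_range`). -/

/-- **The barrier's oracle hypothesis relativised to an instance family `S`**: `O` answers the query
`thermalQuery p m q` with the code of an integer `a`, `|a/(q+1) - ⟨H_{p.2}⟩_{β = m}| ≤ 1/(q+1)`, for
every instance `p ∈ S` (nothing is asked on other strings). `IsIsingThermalOracle` is the case
`S = {p | IsUnitCoupling p.2}` (`isIsingThermalOracle_iff_on`). [cite: TroyerWiese2005, Letter p. 3 (definitions) and Conclusions ("a restricted subclass of quantum systems")] -/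
def IsIsingThermalOracleOn (S : Set (Σ n, Matrix (Fin n) (Fin n) ℤ)) (O : Oracle) : Prop :=
  ∀ p ∈ S, ∀ m q : ℕ, ∃ a : ℤ, O (thermalQuery p m q) = encodingIntBool.encode a ∧
      |(a : ℝ) / (q + 1) - isingThermalEnergy p.2 m| ≤ 1 / (q + 1)

/-- The barrier's hypothesis is the relativised one at the full unit-coupling family. [folklore] -/
theorem isIsingThermalOracle_iff_on (O : Oracle) :
    IsIsingThermalOracle O ↔ IsIsingThermalOracleOn {p | IsUnitCoupling p.2} O :=
  ⟨fun h p hp m q => h p m q hp, fun h p m q hp => h p hp m q⟩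

/-- Correctness on a larger family implies correctness on a smaller one. [folklore] -/
theorem IsIsingThermalOracleOn.anti {S T : Set (Σ n, Matrix (Fin n) (Fin n) ℤ)} (hST : S ⊆ T)
    {O : Oracle} (h : IsIsingThermalOracleOn T O) : IsIsingThermalOracleOn S O :=
  fun p hp m q => h p (hST hp) m q

/-- **The barrier shape on an instance family `S`**: every oracle solving the sign problem for the
family `S` is `NP`-hard under Cook reductions, `NP ⊆ P^O`. The barrier `SignProblemNPHard` is
`SignProblemNPHardOn {p | IsUnitCoupling p.2}` (`signProblemNPHard_iff_on`); the shape is monotone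
in `S` (`SignProblemNPHardOn.mono`: a barrier on a small family is the stronger statement).
[cite: TroyerWiese2005, abstract and Conclusions] -/
def SignProblemNPHardOn (S : Set (Σ n, Matrix (Fin n) (Fin n) ℤ)) : Prop :=
  ∀ O : Oracle, IsIsingThermalOracleOn S O → NP ⊆ PRel O

/-- The barrier is its own shape at the full unit-coupling family. [folklore] -/
theorem signProblemNPHard_iff_on :
    SignProblemNPHard ↔ SignProblemNPHardOn {p | IsUnitCoupling p.2} :=
  ⟨fun h O hO => h O ((isIsingThermalOracle_iff_on O).2 hO),
    fun h O hO => h O ((isIsingThermalOracle_iff_on O).1 hO)⟩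

/-- Monotonicity of the barrier shape in the instance family. [folklore] -/
theorem SignProblemNPHardOn.mono {S T : Set (Σ n, Matrix (Fin n) (Fin n) ℤ)} (hST : S ⊆ T)
    (h : SignProblemNPHardOn S) : SignProblemNPHardOn T :=
  fun O hO => h O (hO.anti hST)

/-- **Thin unit-coupling families**: one instance `𝒥 L` per size parameter `L`, on at least `L`
spins, with couplings in `{0, ±1}` — e.g. a fixed translation-invariant nearest-neighbour pattern on
the `L × L` torus (`L² ≥ L` spins), the instance shape of a uniform lattice model at fixed
couplings ("one instance per problem size"). [cite: GottesmanIrani2013, §2 (Problems and Results)] -/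
def IsThinUnitFamily (𝒥 : ℕ → Σ n, Matrix (Fin n) (Fin n) ℤ) : Prop :=
  (∀ L, L ≤ (𝒥 L).1) ∧ ∀ L, IsUnitCoupling (𝒥 L).2

/-- The uniform all-to-all family with one coupling value `c ∈ {0, ±1}` on `L` spins is a thin
unit-coupling family (non-vacuity of `IsThinUnitFamily`). [folklore] -/
theorem isThinUnitFamily_uniform {c : ℤ} (hc : c = 0 ∨ c = 1 ∨ c = -1) :
    IsThinUnitFamily fun L => ⟨L, fun _ _ => c⟩ :=
  ⟨fun _ => le_rfl, fun _ _ _ => hc⟩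

/-- **NARROWED BARRIER `SignProblemNPHardNarrow` (audit 2026-08-15).** (1) Troyer–Wiese's theorem in
its relativised form: every oracle correct on ALL unit-coupling instances is `NP`-hard
(`SignProblemNPHardOn {p | IsUnitCoupling p.2}`, i.e. `SignProblemNPHard`); (2) the reach of (1)
ends at programmable families: for every THIN unit-coupling family `𝒥` there is an oracle, correct
on `Set.range 𝒥` in the very format of (1), relative to which polynomial time stays inside
`P/poly` — so `SignProblemNPHardOn (Set.range 𝒥) → NP ⊆ P/poly → PH = Σ₂ᵖ`
(`NP_subset_PPoly_of_signProblemNPHardOn_range`, `PH_eq_SigmaP_two_of_signProblemNPHardOn_range`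
in `SignProblemNPHardNarrowProofs.lean`, where this fact is discharged as
`SignProblemNPHardNarrow_holds`): no `NP`-hardness barrier of this shape holds for a
one-instance-per-size family (such as the summit's fixed-`(t, U, δ)` Hubbard family) unless the
polynomial hierarchy collapses. As printed: "If it were instead given in unary, there would only be
one instance per problem size, and the problem would be trivially in P/poly. Thus, in order to prove
a meaningful hardness result, we are forced to move up the exponential hierarchy"; and for the
Hubbard model hardness is only known with site-dependent fields, "the only set of parameters
available to encode a computational problem".

technique_class: generic-sign-problem-cure instance-uniform-polynomial-time-thermal-simulation (programmable-coupling families only)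
blocks: a polynomial-time procedure delivering thermal averages uniformly over ALL `{0, ±1}` coupling matrices (unless `NP ⊆ P^O`); nothing for thin / uniform families [cite: TroyerWiese2005, abstract and Conclusions] [cite: GottesmanIrani2013, §2 (Problems and Results)].
because: (1) is Troyer–Wiese's reduction [cite: TroyerWiese2005, Letter p. 4] with Barahona / Cook–Levin hardness [cite: Barahona1982, §4.2, Theorem (P3 is NP-hard), p. 19]; (2): the canonical correct oracle of a thin family is a polynomial-time truth-table transducer over a SPARSE language (at most `(n+1)⁴` strings per length), and `P^{sparse} ⊆ P/poly` (Meyer) [cite: Schoning1995, §4, Theorem (Karp–Lipton 1980; Berman–Hartmanis 1977), (c) → (a) (pp. 528–529)], whence `NP ⊆ P/poly` and the Karp–Lipton collapse [cite: KarpLipton1980] (cf. [cite: Mahaney1982, Thm. 3.1 and Thm. 4.1–4.2]).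
evasions_known: n/a (this entry IS the evasion map of `SignProblemNPHard`): Hubbard-specific algorithms or certificates, model-specific sign-free designs [cite: LiYao2019, §2.1, §3.1 and §4.2], planar-geometry exact evaluation [cite: Barahona1982, §3.2–§3.3].
scope_caveats: (2) is about the Ising-coded thermal oracle family of this file; the analogous statement for a thermal / correlation oracle of the uniform Hubbard model (queries `L, β, 1/ε` in unary at fixed rational `t, U, μ`) holds by the same sparse-transducer argument but is not formalised (no Hubbard thermal oracle is defined in the tree); thinness is `L ≤ #spins` with ONE instance per `L` — finitely many instances per size, or `O(1)` real parameters read to accuracy `1/poly`, work verbatim but are not stated; (2) says nothing about whether the thin family's energies are actually computable in polynomial time (for TW's planar 2D sub-family they are [cite: Barahona1982, §3.2–§3.3]; for the doped Hubbard model this is open), only that no `NP`-hardness obstruction can exist unless `PH = Σ₂ᵖ`; hardness of uniform families can at best be of the unary-`NEXP` type of translation-invariant tiling / Hamiltonian problems, proved only for specially designed local rules of large local dimension [cite: GottesmanIrani2013, §2 (Problems and Results)], never for the Hubbard interaction; Hubbard hardness theorems use site-dependent fields [cite: SchuchVerstraete2009, arXiv:0712.0483 pp. 2–3].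
status: established ((1): [cite: TroyerWiese2005, Letter p. 4]; (2): proved in `SignProblemNPHardNarrowProofs.lean` from the tree theorems `Literature.Barriers.PneNP.PRel_subset_PPoly_of_isSparseLanguage_holds` and `Literature.Computability.Complexity.karp_lipton_holds`)
[cite: TroyerWiese2005, Conclusions] [cite: GottesmanIrani2013, §2 (Problems and Results)] [cite: SchuchVerstraete2009, arXiv:0712.0483 pp. 2–3] -/
def SignProblemNPHardNarrow : Prop :=
  SignProblemNPHardOn {p | IsUnitCoupling p.2} ∧
    ∀ 𝒥 : ℕ → Σ n, Matrix (Fin n) (Fin n) ℤ, IsThinUnitFamily 𝒥 →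
      ∃ O : Oracle, IsIsingThermalOracleOn (Set.range 𝒥) O ∧ PRel O ⊆ PPoly

/-- The first conjunct of the narrowed fact is the barrier itself. [folklore] -/
theorem SignProblemNPHardNarrow.signProblemNPHard (h : SignProblemNPHardNarrow) : SignProblemNPHard :=
  signProblemNPHard_iff_on.2 h.1

/-- **The dividing line, from the narrowed fact**: the barrier shape on a thin family forces
`NP ⊆ P/poly`. [cite: GottesmanIrani2013, §2 (Problems and Results)] -/
theorem SignProblemNPHardNarrow.NP_subset_PPoly_of_thin (h : SignProblemNPHardNarrow)
    {𝒥 : ℕ → Σ n, Matrix (Fin n) (Fin n) ℤ} (h𝒥 : IsThinUnitFamily 𝒥)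
    (hb : SignProblemNPHardOn (Set.range 𝒥)) : NP ⊆ PPoly := by
  obtain ⟨O, hO, hP⟩ := h.2 𝒥 h𝒥
  exact (hb O hO).trans hP

end Literature.Barriers.HubbardSuperconductivity

end
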